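import Mathlib
import Summits.Ventures.PercRepro2.PMK5Deg2Kernel

/-!
# The twelve-edge Kronecker certificates of the degree-2 family, part 2: the pairs `(0, 4)`, `(1, 2)`, `(1, 3)`
(blind cell PercRepro2, mine-2 g26; `PMK5Deg2Kernel.lean` carries the definitions and the pair `(3, 4)`)

One `decide +kernel` per pair (≈ 100 s each on the farm): `kNeg x y ≤ kPos x y`, `Nat.land (kPos x y − kNeg x y) mask = 0`,
`Nat.land (kNeg x y) mask = 0` — every typed three-copy class sum of `K₃` on `K₅ + {a₃x, a₃y}` is `≥ 0`
(`Deg2Typed.HCov_deg2` turns each into (HCOV) on the pair for every weight vector).  Census twins: kit j258912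
(two own codes, digit for digit), data/mine-2/g26/.
-/

namespace Summit.Ventures.PercRepro2

namespace Deg2

set_option maxRecDepth 100000 in
/-- **The certificate of the pair `(o, b) = (0, 4)`**: every typed three-copy class sum of `K₃` on
`K₅ + {a₃o, a₃b}` is `≥ 0` (census M2-60: 253,100 positive digits, max 8,352), by one `decide +kernel`. -/
theorem cert_04 : Cert 0 4 := by
  unfold Cert
  decide +kernel

set_option maxRecDepth 100000 in
/-- **The certificate of the pair `(a₁, a₂) = (1, 2)`**: every typed three-copy class sum of `K₃` on
`K₅ + {a₃a₁, a₃a₂}` is `≥ 0` (census M2-60: 161,646 positive digits, max 4,272), by one `decide +kernel`. -/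
theorem cert_12 : Cert 1 2 := by
  unfold Cert
  decide +kernel

set_option maxRecDepth 100000 in
/-- **The certificate of the pair `(a₁, u) = (1, 3)`**: every typed three-copy class sum of `K₃` on
`K₅ + {a₃a₁, a₃u}` is `≥ 0` (census M2-60: 239,906 positive digits, max 6,994), by one `decide +kernel`. -/
theorem cert_13 : Cert 1 3 := by
  unfold Cert
  decide +kernel

end Deg2

end Summit.Ventures.PercRepro2
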